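import Mathlib

/-!
# Fat partners of a frame triple in `(ℤ/n)³` — abstract core, I: punctured lines, STEP 2 and STEP 4

Support file for route `MatrixMultiplication/GroupTheoreticSTPP` (target `CThesis`, stmt-MatrixMultiplication-0593),
cell `mm-stpp` (D-0046), theory statement S9 «fat-partner rigidity» (HOME/mm-stpp-theory/FAT-PARTNERS.md):
every triple `(A, B, C)` with `|A| = |B| = |C| = n − 1` forming an STPP pair with the punctured-axes triple
`(P₀, P₁, P₂)` of `(ℤ/n)³` is a common translate of `(P₁, P₂, P₀)` or of `(P₂, P₀, P₁)` (`n ≥ 6`).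

The STPP of the pair unpacks (sequel file `…FatPartnersBasic.lean`) into seven constraints on three finite
sets `X, Y, Z ⊆ (ℤ/n)³` and three coordinates `p, q, r` (a permutation of `0, 1, 2`); this ABSTRACT form is
invariant under the cyclic renaming `(X,Y,Z,p,q,r) ↦ (Y,Z,X,q,r,p)`, which is how the final theorem treats
the cases "`B` is a line", "`C` is a line".  The constraints (section variables below):
`fXY : x_p = y_p ∨ x_q = y_q`, `fYZ : y_q = z_q ∨ y_r = z_r`, `fZX : z_r = x_r ∨ z_p = x_p`;
`gX : (x − x′) + (y − z′) ∉ N_p`, `gY : (y − y′) + (z − x′) ∉ N_q`, `gZ : (z − z′) + (x − y′) ∉ N_r`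
(`N_k` = vectors whose only zero coordinate is `k`); `hinj` : `(x, y, z) ↦ x + y + z` injective;
`|X| = |Y| = |Z| = n − 1`.  This file proves:

* bookkeeping for `(n−1)`-subsets of axis-parallel lines (`eq_of_line`, `exists_pair_of_line`,
  `false_of_line_const`, `mem_iff_of_line`) and `exists_add_eq_add` (two `(n−1)`-subsets of `ZMod n` meet
  each other's translates, `n ≥ 3`);
* `not_line_p` (STEP 2): `X` is not on a line of direction `e_p`;
* `partner_of_lines_rot` (STEP 4): if `X ∥ e_q`, `Y ∥ e_r`, `Z ∥ e_p` then, with `t_p, t_q, t_r` read off the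
  lines, `X, Y, Z` are the three punctured lines through `t` (shape `rot + t`); `partner_of_lines_rot2`
  (STEP 4′): the same for `X ∥ e_r`, `Y ∥ e_p`, `Z ∥ e_q` (shape `rot² + t`).

WHAT THIS IS NOT: STEPS 0, 1, 3 and the assembled theorem are in the sequels; nothing here mentions `ω`.

## References
* H. Cohn, R. Kleinberg, B. Szegedy, C. Umans, FOCS 2005, Def. 5.1, Prop. 5.2.
-/

-- single-conjunct summit: the mandated namespace repeats `MatrixMultiplication`.
set_option linter.dupNamespace false

namespace Summit.MatrixMultiplication.MatrixMultiplication.Theorems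

namespace FatPartners

open Finset

variable {n : ℕ}

/-! ### Punctured axis-parallel lines -/

/-- Two elements of a set lying on an axis-parallel line (coordinates `p, q` constant) with the same free
coordinate `r` are equal. [folklore] -/
theorem eq_of_line {S : Finset (Fin 3 → ZMod n)} {p q r : Fin 3} (hcov : ∀ i : Fin 3, i = p ∨ i = q ∨ i = r)
    {α β : ZMod n} (hS : ∀ s ∈ S, s p = α ∧ s q = β) {s s' : Fin 3 → ZMod n} (hs : s ∈ S) (hs' : s' ∈ S)
    (h : s r = s' r) : s = s' := by
  funext i
  rcases hcov i with rfl | rfl | rfl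
  · rw [(hS s hs).1, (hS s' hs').1]
  · rw [(hS s hs).2, (hS s' hs').2]
  · exact h

/-- A set of size `n − 1 ≥ 2` on a line contains two elements with different free coordinate. [folklore] -/
theorem exists_pair_of_line (hn : 3 ≤ n) {S : Finset (Fin 3 → ZMod n)} {p q r : Fin 3}
    (hcov : ∀ i : Fin 3, i = p ∨ i = q ∨ i = r) {α β : ZMod n} (hS : ∀ s ∈ S, s p = α ∧ s q = β)
    (hcard : S.card = n - 1) : ∃ s ∈ S, ∃ s' ∈ S, s r ≠ s' r := by
  have h2 : 1 < S.card := by rw [hcard]; omega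
  obtain ⟨s, hs, s', hs', hne⟩ := Finset.one_lt_card.1 h2
  exact ⟨s, hs, s', hs', fun h => hne (eq_of_line hcov hS hs hs' h)⟩

/-- A set of size `n − 1` on a line cannot have all its elements share the free coordinate too. [folklore] -/
theorem false_of_line_const (hn : 3 ≤ n) {S : Finset (Fin 3 → ZMod n)} {p q r : Fin 3}
    (hcov : ∀ i : Fin 3, i = p ∨ i = q ∨ i = r) {α β : ZMod n} (hS : ∀ s ∈ S, s p = α ∧ s q = β)
    (hcard : S.card = n - 1) {v : ZMod n} (hconst : ∀ s ∈ S, s r = v) : False := by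
  obtain ⟨s, hs, s', hs', hne⟩ := exists_pair_of_line hn hcov hS hcard
  exact hne ((hconst s hs).trans (hconst s' hs').symm)

/-- **Completing a punctured line.**  A set of size `n − 1` on the line `{x_p = α, x_q = β}` which avoids
the value `v₀` in the free coordinate `r` is exactly the line minus the point with `x_r = v₀`. [folklore] -/
theorem mem_iff_of_line [NeZero n] {S : Finset (Fin 3 → ZMod n)} {p q r : Fin 3}
    (hcov : ∀ i : Fin 3, i = p ∨ i = q ∨ i = r) {α β : ZMod n} (hS : ∀ s ∈ S, s p = α ∧ s q = β)
    (hcard : S.card = n - 1) {v₀ : ZMod n} (hv : ∀ s ∈ S, s r ≠ v₀) (x : Fin 3 → ZMod n) :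
    x ∈ S ↔ x p = α ∧ x q = β ∧ x r ≠ v₀ := by
  constructor
  · intro hx; exact ⟨(hS x hx).1, (hS x hx).2, hv x hx⟩
  · rintro ⟨hp, hq, hr⟩
    have hinj : Set.InjOn (fun s : Fin 3 → ZMod n => s r) ↑S :=
      fun s hs s' hs' h => eq_of_line hcov hS hs hs' h
    have hsub : S.image (fun s => s r) ⊆ Finset.univ.erase v₀ := by
      intro w hw
      obtain ⟨s, hs, rfl⟩ := Finset.mem_image.1 hw
      exact Finset.mem_erase.2 ⟨hv s hs, Finset.mem_univ _⟩
    have heq : S.image (fun s => s r) = Finset.univ.erase v₀ := by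
      apply Finset.eq_of_subset_of_card_le hsub
      rw [Finset.card_erase_of_mem (Finset.mem_univ _), Finset.card_univ, ZMod.card,
        Finset.card_image_of_injOn hinj, hcard]
    have hxr : x r ∈ S.image (fun s => s r) := by
      rw [heq]; exact Finset.mem_erase.2 ⟨hr, Finset.mem_univ _⟩
    obtain ⟨s, hs, hsr⟩ := Finset.mem_image.1 hxr
    have : s = x := by
      funext i
      rcases hcov i with rfl | rfl | rfl
      · rw [(hS s hs).1, hp]
      · rw [(hS s hs).2, hq]
      · exact hsr
    rw [← this]; exact hs

/-- Two subsets of `ZMod n` of size `n − 1` (`n ≥ 3`) meet after any translations: there are `y ∈ Y`,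
`y' ∈ Y'` with `y + s = y' + s'`. [folklore] -/
theorem exists_add_eq_add [NeZero n] (hn : 3 ≤ n) {Y Y' : Finset (ZMod n)} (hY : Y.card = n - 1)
    (hY' : Y'.card = n - 1) (s s' : ZMod n) : ∃ y ∈ Y, ∃ y' ∈ Y', y + s = y' + s' := by
  by_contra h
  push Not at h
  have hdisj : Disjoint (Y.image (· + s)) (Y'.image (· + s')) := by
    rw [Finset.disjoint_left]
    intro v hv hv'
    obtain ⟨y, hy, rfl⟩ := Finset.mem_image.1 hv
    obtain ⟨y', hy', he⟩ := Finset.mem_image.1 hv'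
    exact h y hy y' hy' he.symm
  have hcard := Finset.card_le_univ (Y.image (· + s) ∪ Y'.image (· + s'))
  rw [Finset.card_union_of_disjoint hdisj,
    Finset.card_image_of_injective _ (add_left_injective s),
    Finset.card_image_of_injective _ (add_left_injective s'), hY, hY', ZMod.card] at hcard
  omega

/-! ### The abstract constraint system -/

section Abstract

variable [NeZero n] {X Y Z : Finset (Fin 3 → ZMod n)} {p q r : Fin 3} (hn : 3 ≤ n)
  (hcov : ∀ i : Fin 3, i = p ∨ i = q ∨ i = r)
  (fXY : ∀ x ∈ X, ∀ y ∈ Y, x p = y p ∨ x q = y q)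
  (fYZ : ∀ y ∈ Y, ∀ z ∈ Z, y q = z q ∨ y r = z r)
  (fZX : ∀ z ∈ Z, ∀ x ∈ X, z r = x r ∨ z p = x p)
  (gX : ∀ x ∈ X, ∀ x' ∈ X, ∀ y ∈ Y, ∀ z' ∈ Z,
    (x - x' + (y - z')) q = 0 ∨ (x - x' + (y - z')) r = 0 ∨ (x - x' + (y - z')) p ≠ 0)
  (gY : ∀ y ∈ Y, ∀ y' ∈ Y, ∀ z ∈ Z, ∀ x' ∈ X,
    (y - y' + (z - x')) r = 0 ∨ (y - y' + (z - x')) p = 0 ∨ (y - y' + (z - x')) q ≠ 0)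
  (gZ : ∀ z ∈ Z, ∀ z' ∈ Z, ∀ x ∈ X, ∀ y' ∈ Y,
    (z - z' + (x - y')) p = 0 ∨ (z - z' + (x - y')) q = 0 ∨ (z - z' + (x - y')) r ≠ 0)
  (hinj : ∀ x ∈ X, ∀ x' ∈ X, ∀ y ∈ Y, ∀ y' ∈ Y, ∀ z ∈ Z, ∀ z' ∈ Z,
    x + y + z = x' + y' + z' → x = x' ∧ y = y' ∧ z = z')
  (hXc : X.card = n - 1) (hYc : Y.card = n - 1) (hZc : Z.card = n - 1)

include hcov in
/-- Rotated coverings of the three coordinates. [folklore] -/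
theorem covers :
    (∀ i : Fin 3, i = q ∨ i = r ∨ i = p) ∧ (∀ i : Fin 3, i = p ∨ i = r ∨ i = q) ∧
    (∀ i : Fin 3, i = q ∨ i = p ∨ i = r) ∧ (∀ i : Fin 3, i = r ∨ i = p ∨ i = q) ∧
    (∀ i : Fin 3, i = r ∨ i = q ∨ i = p) := by
  refine ⟨fun i => ?_, fun i => ?_, fun i => ?_, fun i => ?_, fun i => ?_⟩ <;>
    rcases hcov i with h | h | h <;> simp [h]

include hn hcov fXY fYZ fZX hinj hXc hYc hZc in
/-- **STEP 2.**  `X` is not contained in a line of direction `e_p`: otherwise `fXY` and `fZX` put `Y`, `Z`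
in the planes `x_q = const`, `x_r = const`, sum-injectivity makes them graphs over `r`, `q`, and `fYZ`
fails. [cite: CohnKleinbergSzegedyUmans2005, Def. 5.1] -/
theorem not_line_p {α β : ZMod n} (hXl : ∀ x ∈ X, x q = α ∧ x r = β) : False := by
  obtain ⟨c1, -, -, -, -⟩ := covers hcov
  -- `X` projects injectively onto coordinate `p`
  have hXinj : Set.InjOn (fun x : Fin 3 → ZMod n => x p) ↑X :=
    fun x hx x' hx' h => eq_of_line c1 hXl hx hx' h
  have hP : (X.image fun x => x p).card = n - 1 := by rw [Finset.card_image_of_injOn hXinj, hXc]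
  obtain ⟨x₁, hx₁, x₂, hx₂, hxne⟩ := exists_pair_of_line hn c1 hXl hXc
  -- `Y ⊆ {x_q = α}`, `Z ⊆ {x_r = β}`
  have hYq : ∀ y ∈ Y, y q = α := by
    intro y hy
    rcases fXY x₁ hx₁ y hy with h | h
    · rcases fXY x₂ hx₂ y hy with h' | h'
      · exact absurd (h.trans h'.symm) hxne
      · rw [← h', (hXl x₂ hx₂).1]
    · rw [← h, (hXl x₁ hx₁).1]
  have hZr : ∀ z ∈ Z, z r = β := by
    intro z hz
    rcases fZX z hz x₁ hx₁ with h | h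
    · rw [h, (hXl x₁ hx₁).2]
    · rcases fZX z hz x₂ hx₂ with h' | h'
      · rw [h', (hXl x₂ hx₂).2]
      · exact absurd (h.symm.trans h') hxne
  obtain ⟨z₀, hz₀⟩ : Z.Nonempty := by rw [← Finset.card_pos, hZc]; omega
  obtain ⟨y₀, hy₀⟩ : Y.Nonempty := by rw [← Finset.card_pos, hYc]; omega
  -- `Y` is a graph over `r`, `Z` a graph over `q`
  have hYinj : Set.InjOn (fun y : Fin 3 → ZMod n => y r) ↑Y := by
    intro y hy y' hy' (hr' : y r = y' r)
    obtain ⟨u, hu, u', hu', huu⟩ := exists_add_eq_add hn hP hP (y p) (y' p)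
    obtain ⟨x, hx, rfl⟩ := Finset.mem_image.1 hu
    obtain ⟨x', hx', rfl⟩ := Finset.mem_image.1 hu'
    have hsum : x + y + z₀ = x' + y' + z₀ := by
      funext i; rcases hcov i with rfl | rfl | rfl
      · simpa [add_comm, add_left_comm, add_assoc] using congrArg (· + z₀ i) huu
      · simp [(hXl x hx).1, (hXl x' hx').1, hYq y hy, hYq y' hy']
      · simp [(hXl x hx).2, (hXl x' hx').2, hr']
    exact (hinj x hx x' hx' y hy y' hy' z₀ hz₀ z₀ hz₀ hsum).2.1
  have hZinj : Set.InjOn (fun z : Fin 3 → ZMod n => z q) ↑Z := by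
    intro z hz z' hz' (hq' : z q = z' q)
    obtain ⟨u, hu, u', hu', huu⟩ := exists_add_eq_add hn hP hP (z p) (z' p)
    obtain ⟨x, hx, rfl⟩ := Finset.mem_image.1 hu
    obtain ⟨x', hx', rfl⟩ := Finset.mem_image.1 hu'
    have hsum : x + y₀ + z = x' + y₀ + z' := by
      funext i; rcases hcov i with rfl | rfl | rfl
      · simpa [add_comm, add_left_comm, add_assoc] using congrArg (· + y₀ i) huu
      · simp [(hXl x hx).1, (hXl x' hx').1, hq']
      · simp [(hXl x hx).2, (hXl x' hx').2, hZr z hz, hZr z' hz']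
    exact (hinj x hx x' hx' y₀ hy₀ y₀ hy₀ z hz z' hz' hsum).2.2
  have hYcard : (Y.image fun y => y r).card = n - 1 := by rw [Finset.card_image_of_injOn hYinj, hYc]
  have hZcard : (Z.image fun z => z q).card = n - 1 := by rw [Finset.card_image_of_injOn hZinj, hZc]
  -- some `y` with `y_r ≠ β` and some `z` with `z_q ≠ α`; then `fYZ` fails
  have key : ∀ (S : Finset (Fin 3 → ZMod n)) (k : Fin 3) (w : ZMod n),
      (S.image fun s => s k).card = n - 1 → ∃ s ∈ S, s k ≠ w := by
    intro S k w hS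
    by_contra h
    push Not at h
    have hsub : (S.image fun s => s k) ⊆ {w} := by
      intro v hv
      obtain ⟨s, hs, rfl⟩ := Finset.mem_image.1 hv
      exact Finset.mem_singleton.2 (h s hs)
    have := Finset.card_le_card hsub
    rw [hS, Finset.card_singleton] at this
    omega
  obtain ⟨y, hy, hyr⟩ := key Y r β hYcard
  obtain ⟨z, hz, hzq⟩ := key Z q α hZcard
  rcases fYZ y hy z hz with h | h
  · exact hzq (h.symm.trans (hYq y hy))
  · exact hyr (h.trans (hZr z hz))

omit [NeZero n] in
include hn hcov fXY hXc in
/-- From `fXY` and a line `X ∥ e_q` (`x_p = a_p`, `x_r = a_r`): every `y` has `y_p = a_p`. [folklore] -/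
theorem fst_eq_of_line_q {a_p a_r : ZMod n}
    (hXl : ∀ x ∈ X, x p = a_p ∧ x r = a_r) : ∀ y ∈ Y, y p = a_p := by
  obtain ⟨-, c2, -, -, -⟩ := covers hcov
  obtain ⟨x₁, hx₁, x₂, hx₂, hxne⟩ := exists_pair_of_line hn c2 hXl hXc
  intro y hy
  rcases fXY x₁ hx₁ y hy with h | h
  · rw [← h, (hXl x₁ hx₁).1]
  · rcases fXY x₂ hx₂ y hy with h' | h'
    · rw [← h', (hXl x₂ hx₂).1]
    · exact absurd (h.trans h'.symm) hxne

include hn hcov fXY fYZ fZX gX gY gZ hXc hYc hZc in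
/-- **STEP 4 (shape `rot`).**  If `X ⊆ {x_p = a_p, x_r = a_r}`, `Y ⊆ {x_p = b_p, x_q = b_q}`,
`Z ⊆ {x_q = c_q, x_r = c_r}` then `b_p = a_p`, `c_q = b_q`, `c_r = a_r` and, with `t = (a_p, b_q, a_r)`,
`X`, `Y`, `Z` are the punctured lines through `t` in directions `e_q`, `e_r`, `e_p`.
[cite: CohnKleinbergSzegedyUmans2005, Def. 5.1 and Prop. 5.2] -/
theorem partner_of_lines_rot {a_p a_r b_p b_q c_q c_r : ZMod n}
    (hXl : ∀ x ∈ X, x p = a_p ∧ x r = a_r) (hYl : ∀ y ∈ Y, y p = b_p ∧ y q = b_q)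
    (hZl : ∀ z ∈ Z, z q = c_q ∧ z r = c_r) :
    b_p = a_p ∧ c_q = b_q ∧ c_r = a_r ∧
    (∀ v, v ∈ X ↔ v p = a_p ∧ v r = a_r ∧ v q ≠ b_q) ∧
    (∀ v, v ∈ Y ↔ v p = a_p ∧ v q = b_q ∧ v r ≠ a_r) ∧
    (∀ v, v ∈ Z ↔ v q = b_q ∧ v r = a_r ∧ v p ≠ a_p) := by
  obtain ⟨c1, c2, -, -, -⟩ := covers hcov
  -- cX : p, r, q (free q); cY : p, q, r (free r); cZ : q, r, p (free p)
  obtain ⟨x₁, hx₁, x₂, hx₂, hxne⟩ := exists_pair_of_line hn c2 hXl hXc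
  obtain ⟨y₁, hy₁, y₂, hy₂, hyne⟩ := exists_pair_of_line hn hcov hYl hYc
  obtain ⟨z₁, hz₁, z₂, hz₂, hzne⟩ := exists_pair_of_line hn c1 hZl hZc
  -- (1) the lines pass through `t`
  have hb : b_p = a_p := by
    rw [← (hYl y₁ hy₁).1]
    exact fst_eq_of_line_q hn hcov fXY hXc hXl y₁ hy₁
  have hc : c_q = b_q := by
    rw [← (hZl z₁ hz₁).1]
    rcases fYZ y₁ hy₁ z₁ hz₁ with h | h
    · rw [← h, (hYl y₁ hy₁).2]
    · rcases fYZ y₂ hy₂ z₁ hz₁ with h' | h'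
      · rw [← h', (hYl y₂ hy₂).2]
      · exact absurd (h.trans h'.symm) hyne
  have hc' : c_r = a_r := by
    rw [← (hZl z₁ hz₁).2]
    rcases fZX z₁ hz₁ x₁ hx₁ with h | h
    · rw [h, (hXl x₁ hx₁).2]
    · rcases fZX z₂ hz₂ x₁ hx₁ with h' | h'
      · rw [(hZl z₁ hz₁).2, ← (hZl z₂ hz₂).2, h', (hXl x₁ hx₁).2]
      · exact absurd (h.trans h'.symm) hzne
  -- (2) the missing points
  have hXmiss : ∀ x ∈ X, x q ≠ b_q := by
    intro x hx hq0
    refine false_of_line_const hn c1 hZl hZc (v := a_p) fun z hz => ?_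
    rcases gY y₁ hy₁ y₂ hy₂ z hz x hx with h | h | h
    · exact absurd (by simpa [(hZl z hz).2, hc', (hXl x hx).2, sub_eq_zero] using h) hyne
    · simpa [(hYl y₁ hy₁).1, (hYl y₂ hy₂).1, (hXl x hx).1, sub_eq_zero] using h
    · exact absurd (by simp [(hYl y₁ hy₁).2, (hYl y₂ hy₂).2, (hZl z hz).1, hc, hq0]) h
  have hYmiss : ∀ y ∈ Y, y r ≠ a_r := by
    intro y hy hr0
    refine false_of_line_const hn c2 hXl hXc (v := b_q) fun x hx => ?_
    rcases gZ z₁ hz₁ z₂ hz₂ x hx y hy with h | h | h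
    · exact absurd (by simpa [(hXl x hx).1, (hYl y hy).1, hb, sub_eq_zero] using h) hzne
    · simpa [(hZl z₁ hz₁).1, (hZl z₂ hz₂).1, (hYl y hy).2, sub_eq_zero] using h
    · exact absurd (by simp [(hZl z₁ hz₁).2, (hZl z₂ hz₂).2, (hXl x hx).2, hr0]) h
  have hZmiss : ∀ z ∈ Z, z p ≠ a_p := by
    intro z hz hp0
    refine false_of_line_const hn hcov hYl hYc (v := a_r) fun y hy => ?_
    rcases gX x₁ hx₁ x₂ hx₂ y hy z hz with h | h | h
    · exact absurd (by simpa [(hYl y hy).2, (hZl z hz).1, hc, sub_eq_zero] using h) hxne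
    · simpa [(hXl x₁ hx₁).2, (hXl x₂ hx₂).2, (hZl z hz).2, hc', sub_eq_zero] using h
    · exact absurd (by simp [(hXl x₁ hx₁).1, (hXl x₂ hx₂).1, (hYl y hy).1, hb, hp0]) h
  refine ⟨hb, hc, hc', fun v => ?_, fun v => ?_, fun v => ?_⟩
  · exact mem_iff_of_line c2 hXl hXc hXmiss v
  · have := mem_iff_of_line hcov hYl hYc hYmiss v
    rw [hb] at this; exact this
  · have := mem_iff_of_line c1 hZl hZc hZmiss v
    rw [hc, hc'] at this; exact this

include hn hcov fXY fYZ fZX gX gY gZ hXc hYc hZc in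
/-- **STEP 4′ (shape `rot²`).**  If `X ⊆ {x_p = a_p, x_q = a_q}`, `Y ⊆ {x_q = b_q, x_r = b_r}`,
`Z ⊆ {x_p = c_p, x_r = c_r}` then `b_q = a_q`, `c_r = b_r`, `c_p = a_p` and, with `t = (a_p, a_q, b_r)`,
`X`, `Y`, `Z` are the punctured lines through `t` in directions `e_r`, `e_p`, `e_q`.
[cite: CohnKleinbergSzegedyUmans2005, Def. 5.1 and Prop. 5.2] -/
theorem partner_of_lines_rot2 {a_p a_q b_q b_r c_p c_r : ZMod n}
    (hXl : ∀ x ∈ X, x p = a_p ∧ x q = a_q) (hYl : ∀ y ∈ Y, y q = b_q ∧ y r = b_r)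
    (hZl : ∀ z ∈ Z, z p = c_p ∧ z r = c_r) :
    b_q = a_q ∧ c_r = b_r ∧ c_p = a_p ∧
    (∀ v, v ∈ X ↔ v p = a_p ∧ v q = a_q ∧ v r ≠ b_r) ∧
    (∀ v, v ∈ Y ↔ v q = a_q ∧ v r = b_r ∧ v p ≠ a_p) ∧
    (∀ v, v ∈ Z ↔ v p = a_p ∧ v r = b_r ∧ v q ≠ a_q) := by
  obtain ⟨c1, c2, -, -, -⟩ := covers hcov
  -- X : (p,q | r) = hcov;  Y : (q,r | p) = c1;  Z : (p,r | q) = c2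
  obtain ⟨x₁, hx₁, x₂, hx₂, hxne⟩ := exists_pair_of_line hn hcov hXl hXc
  obtain ⟨y₁, hy₁, y₂, hy₂, hyne⟩ := exists_pair_of_line hn c1 hYl hYc
  obtain ⟨z₁, hz₁, z₂, hz₂, hzne⟩ := exists_pair_of_line hn c2 hZl hZc
  have hb : b_q = a_q := by
    rw [← (hYl y₁ hy₁).1]
    rcases fXY x₁ hx₁ y₁ hy₁ with h | h
    · rcases fXY x₁ hx₁ y₂ hy₂ with h' | h'
      · exact absurd (h.symm.trans h') hyne
      · rw [(hYl y₁ hy₁).1, ← (hYl y₂ hy₂).1, ← h', (hXl x₁ hx₁).2]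
    · rw [← h, (hXl x₁ hx₁).2]
  have hc : c_r = b_r := by
    rcases fYZ y₁ hy₁ z₁ hz₁ with h | h
    · rcases fYZ y₁ hy₁ z₂ hz₂ with h' | h'
      · exact absurd (h.symm.trans h') hzne
      · rw [← (hZl z₂ hz₂).2, ← h', (hYl y₁ hy₁).2]
    · rw [← (hZl z₁ hz₁).2, ← h, (hYl y₁ hy₁).2]
  have hc' : c_p = a_p := by
    rcases fZX z₁ hz₁ x₁ hx₁ with h | h
    · rcases fZX z₁ hz₁ x₂ hx₂ with h' | h'
      · exact absurd (h.symm.trans h') hxne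
      · rw [← (hZl z₁ hz₁).1, h', (hXl x₂ hx₂).1]
    · rw [← (hZl z₁ hz₁).1, h, (hXl x₁ hx₁).1]
  have hXmiss : ∀ x ∈ X, x r ≠ b_r := by
    intro x hx hr0
    refine false_of_line_const hn c1 hYl hYc (v := a_p) fun y hy => ?_
    rcases gZ z₁ hz₁ z₂ hz₂ x hx y hy with h | h | h
    · have h' : a_p = y p := by
        simpa [(hZl z₁ hz₁).1, (hZl z₂ hz₂).1, (hXl x hx).1, sub_eq_zero] using h
      exact h'.symm
    · exact absurd (by simpa [(hXl x hx).2, (hYl y hy).1, hb, sub_eq_zero] using h) hzne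
    · exact absurd (by simp [(hZl z₁ hz₁).2, (hZl z₂ hz₂).2, hr0, (hYl y hy).2]) h
  have hYmiss : ∀ y ∈ Y, y p ≠ a_p := by
    intro y hy hp0
    refine false_of_line_const hn c2 hZl hZc (v := a_q) fun z hz => ?_
    rcases gX x₁ hx₁ x₂ hx₂ y hy z hz with h | h | h
    · have h' : a_q = z q := by
        simpa [(hXl x₁ hx₁).2, (hXl x₂ hx₂).2, (hYl y hy).1, hb, sub_eq_zero] using h
      exact h'.symm
    · exact absurd (by simpa [(hYl y hy).2, (hZl z hz).2, hc, sub_eq_zero] using h) hxne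
    · exact absurd (by simp [(hXl x₁ hx₁).1, (hXl x₂ hx₂).1, hp0, (hZl z hz).1, hc']) h
  have hZmiss : ∀ z ∈ Z, z q ≠ a_q := by
    intro z hz hq0
    refine false_of_line_const hn hcov hXl hXc (v := b_r) fun x hx => ?_
    rcases gY y₁ hy₁ y₂ hy₂ z hz x hx with h | h | h
    · have h' : b_r = x r := by
        simpa [(hYl y₁ hy₁).2, (hYl y₂ hy₂).2, (hZl z hz).2, hc, sub_eq_zero] using h
      exact h'.symm
    · exact absurd (by simpa [(hZl z hz).1, hc', (hXl x hx).1, sub_eq_zero] using h) hyne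
    · exact absurd (by simp [(hYl y₁ hy₁).1, (hYl y₂ hy₂).1, hq0, (hXl x hx).2, hb]) h
  refine ⟨hb, hc, hc', fun v => ?_, fun v => ?_, fun v => ?_⟩
  · exact mem_iff_of_line hcov hXl hXc hXmiss v
  · have := mem_iff_of_line c1 hYl hYc hYmiss v
    rw [hb] at this; exact this
  · have := mem_iff_of_line c2 hZl hZc hZmiss v
    rw [hc', hc] at this; exact this

end Abstract

end FatPartners

end Summit.MatrixMultiplication.MatrixMultiplication.Theorems
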